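import Literature.MathematicalPhysics.QuantumFieldTheory.Balaban1983to89.B9Eq364GreenLipschitzForm
import Literature.MathematicalPhysics.QuantumFieldTheory.Balaban1983to89.B9Thm311SitePrimeFormCoerciveCanonical
import Literature.MathematicalPhysics.QuantumFieldTheory.Balaban1983to89.B9Eq365QGGQLowerVariational

/-!
# `Balaban1983to89.B9Eq325RLipschitzClosed` — T. Bałaban, *Propagators for lattice gauge theories in a background field*, Commun. Math. Phys.
# **99** (1985) 389–434 [Balaban1985BackgroundPropagators] p. 403 with (3.25) p. 394: **«THE OPERATORS R(U), P(U) = I − R(U) … SATISFY THE SAME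
# BOUNDS» — `‖R(U) − R(1)‖ ≤ C_R♯` FOR THE pub-balaban NE9 CHAIN'S GAUGE-FIXING PROJECTION WITH EVERY LETTER DISCHARGED FROM THE TREE**, and on
# Bałaban's diagonal `ηL = 1`, `εR = K·α·η` a constant depending on `(d, a′, K, α)` ONLY — the closure of sub-step S3 (S3a–S3d) of route R2′ STEP B7′

statement-level skeleton of published theorems with citation tags; proofs where landed; nothing here is a claim about the Yang–Mills mass gap

CITATION HEADER (lean-in-tree rule).  Audit cell `pub-balaban`, sub-cell `t4`, BINDER row NE9; filed by NE9 formalisation-swarm leaf prover 06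
(`b2b-balaban-t4-ne9-formalise-leaf-06`, gen 64) as the CLOSURE of sub-step S3 of route R2′ STEP B7′ (`t4/ROUTES-NE9.md` v13.19 l.411: «S3d (XS):
assemble (3.25): `‖R_U − R_1‖ ≤ C_R♯·α`, `C_R♯ = C_R♯(d, a, M_φ, M_φ′)`»).  Source READ in the held text: [Balaban1985BackgroundPropagators]
pp. 394, 402–403, 416 (`paper:balaban1985-cmp99-background-propagators`, journal page = PDF page + 388).

THE PRINT (verbatim).  p. 394 (3.25): *«Rf = (I − G′Q′*(Q′G′²Q′*)⁻¹Q′G′)f, where G′ = G′(U) = (Δ′_a)⁻¹.»*  p. 403, after (3.63)–(3.68): *«These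
results imply that the operators R(U), P(U) = I − R(U) extend analytically to the domain (3.37) and satisfy the same bounds.»*  Thm 3.11 p. 416:
*«Δ′_a, G′, (Q′G′²Q′*)⁻¹, Δ_a, G are positive definite».*

WHY (route R2′ STEP B7′ S3, «letters in, numbers out»).  `B9Eq325RLipschitzResolvent.norm_RofU_sub_RofU_le` (S3d) turns FIVE displayed letters
`(γ, θ_G, M_Q, θ_Q, κ)` into `‖R(U₁)f − R(U₂)f‖ ≤ C_R♯·‖f‖`.  At `(U, 1)` every letter is now a tree theorem: `γ` ← NE9 leaf-03's
`B9Thm311SitePrimeFormCoerciveCanonical.strong_site_coercive_canonical` (at `U`) ∕ `B9Thm311SitePrimeFormCoercive.flat_site_strong_coercive` (at `1`);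
`θ_G` ← `B9Eq364GreenLipschitzForm.norm_GpOfU_sub_GpOfU_le` with `δ_D = √d·‖η⁻¹‖εR` (`B9Eq373DerivativeRemainderL2.norm_covDerivL2K_sub_le`); `M_Q`,
`θ_Q` ← leaf-03's `norm_Qtilde_flat_le` ∕ `norm_Qtilde_sub_flat_le`; `κ` ← NE9 leaf-01's `B9Eq365QGGQLowerVariational.qggq_coercive_one` at `1` and the
WEYL step `κ(U) ≥ κ(1) − δ_K` with S3d's `norm_Kp_sub_Kp_le` (leaf-01's `B9Eq365QGGQLowerVariationalWindow.qggq_coercive_window` is the direct `κ_U`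
for the same slot — the alternative road, not used here).

WHAT IS PROVED (sorry-free; proof lane — no `def`, no `Prop` placeholder, nothing of [B9] asserted hypothesis-free).
* §1 (abstract, `RCLike 𝕜`): `pos_of_coercive`, **`coercive_of_near`** (Weyl: `κ‖y‖² ≤ re⟪y, K₁y⟫`, `‖K₁y − K₂y‖ ≤ δ‖y‖` ⇒ `(κ − δ)‖y‖² ≤ re⟪y, K₂y⟫`).
* §2 **`norm_RofU_sub_RofU_one_le_of_letters`** — at a background `U` with mutually adjoint transporters (`hRS`) `εR`-close to the identity, `η ≠ 0`,
  `0 < ηL ≤ 1`, `c₁(ηL)² = c₀L^d`, `0 < a′`: `‖R(U)f − R(1)f‖ ≤ C_R♯(γ, θ_G, M_Q, θ_Q, κ)·‖f‖`, the five letters FIXED by definitional equalities in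
  three primitive letters `t ≥ ‖η⁻¹‖εR`, `ρ ≥ (1+εR)^{d(L−1)} − 1`, `κ₀` (a FORM minorant of the flat `Q̃′G′(1)²Q̃′†`, slot `hκ1`) and `s = (ηL)⁻¹`: `γ = (1∕(2+2∕a′) − (√d·t + d·t² + a′ρs(2s + ρs)))·s²`,
  `M_Q = (1+ρ)s`, `θ_Q = ρs`, `θ_G = 2√d·t·γ⁻¹(√γ)⁻¹ + |a′|θ_Q·2M_Q·γ⁻²`, `δ_K = M_Q(γ⁻¹(γ⁻¹θ_Q + θ_GM_Q) + θ_Gγ⁻¹M_Q) + θ_Qγ⁻²M_Q`, `κ = κ₀ − δ_K`;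
  the WINDOW is the pair `0 < γ`, `0 < κ`.
* §3 `rho_le_exp_sub_one`, **`norm_RofU_sub_RofU_one_le_diagonal`** — ON BAŁABAN's DIAGONAL `ηL = 1`, `c₀L^d = c₁`, `εR = K·α·η` (`K = 2M_φM_φ′`
  in the chain): `t = Kα`, `ρ = e^{dKα} − 1`, `s = 1`, `κ₀ = 1∕(16d(729∕16)^d + a′)²` (leaf-01's `qggq_constant_diagonal_ge`) — EVERY letter, hence
  `C_R♯` and the window, a closed function of `(d, a′, K, α)`: no `η`, `L`, period `m`, `c₀, c₁`, no operator norm of `Δ′_a`.  CONSUMER (by type): NE9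
  leaf-03's `B9Eq382FormRelativeNearFlat.strong_coercive_of_form_near_flat_canonical` slot `hR : ∀ y, ‖RofU … U y − RofU … 1 y‖ ≤ δ_R‖y‖`; the OWNER's S4.
HONEST SCOPE.  [folklore] finite-dimensional Hilbert-space algebra (Weyl) and real arithmetic composing landed letters; the η-, L-, m-freeness on the
diagonal is a property of the DISPLAYED closed forms, not a theorem about Bałaban's operators beyond the chain's model (one averaging step, weights `c₀,
c₁`, scalar `η⁻¹`).  NUMERICALLY the window is void as fed today: with the analytic floor `κ₀ = 1∕(16d(729∕16)^d + a′)² ≈ 1.3·10⁻¹⁷` (d = 4, a′ = 1)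
and `δ_K ≈ 2.8·10³·α` (K = 2) the Weyl condition `κ > 0` needs `α ≲ 5·10⁻²¹` and `C_R♯ ∝ κ⁻²` — the value of §3 is structural until the flat letter `κ(1)`
(print: «a positive absolute constant», [Balaban1984PropagatorsII] (2.78)) is sharpened; `κ₀` is a LETTER here, so that drops in.  ONE sub-step (S3) of a route step, NOT NE9 (cell pub-balaban: NE9 NOT PRINTED ∕ NOT PROVED; «NE9 ⇐ the named binders»; spine
PROVED 0∕9; rung (B)+1 on a finite T⁴ — NOT infinite volume, NOT mass gap, NOT Clay; HONEST DEPENDENCY: continuum YM on T⁴ ⇐ BetaPertH ∧ nine spine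
estimates (0/9 proved); BetaPertH ⇐ (D1) ∧ (D4) ∧ CAP+tail; G-an2-4 gates asym, D1 and NE2/3/4).  NEW file; nothing modified.  Net new unproved facts: 0.
-/

noncomputable section

open scoped InnerProductSpace ComplexConjugate BigOperators

namespace Literature.MathematicalPhysics.QuantumFieldTheory.Balaban1983to89.B9Eq325RLipschitzClosed

open B4Sect5Torus (TSite)
open B9SectCLatticeCarrier (Bond)
open B9Eq311L2Pairing (WL2)
open B9Eq319QprimeTorus (fineP)
open B11Eq103H1Complex (SiteL2K greenK covDerivL2K)
open B9Eq310HessianOperator (adTransportW)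
open B5Eq172HodgePositivity (adTransportW_one hRS_one)
open B9Eq326OperatorAssembly (QprimeW RofU)
open B9Eq3119DeltaPiCarrier (laplacePrimeA GpOfU)
open B9Thm311DeltaPrimeA (laplacePrimeA_one_pos)
open B9Eq373DerivativeRemainderL2 (norm_covDerivL2K_sub_le)
open B9Eq319QprimeLipschitz (rho_nonneg)
open B9Eq325RLipschitzResolvent (norm_RofU_sub_RofU_le norm_Kp_sub_Kp_le)
open B9Eq364GreenLipschitzForm (norm_GpOfU_sub_GpOfU_le)
open B9Thm311SitePrimeFormCoercive (flat_site_strong_coercive)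
open B9Thm311SitePrimeFormCoerciveCanonical (strong_site_coercive_canonical norm_Qtilde_sub_flat_le norm_Qtilde_flat_le)
open B9Eq365QGGQLowerVariational (qggq_coercive_one qggq_constant_diagonal_ge)

/-! ## §1 Two abstract steps: coercive ⇒ positive definite; the Weyl step -/

section Abstract

variable {𝕜 : Type*} [RCLike 𝕜] {F : Type*} [NormedAddCommGroup F] [InnerProductSpace 𝕜 F]

/-- A `γ`-coercive operator with `γ > 0` is positive definite (the `hpos′` letter of `B9Eq325ProjFormula.RofU_eq_formula` from a displayed coercivity).
[folklore] [cite: Balaban1985BackgroundPropagators, Thm 3.11 p.416] -/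
theorem pos_of_coercive {T : F →ₗ[𝕜] F} {γ : ℝ} (hγ : 0 < γ) (hc : ∀ x, γ * ‖x‖ ^ 2 ≤ RCLike.re ⟪x, T x⟫_𝕜) (x : F) (hx : x ≠ 0) :
    0 < RCLike.re ⟪x, T x⟫_𝕜 :=
  lt_of_lt_of_le (mul_pos hγ (pow_pos (norm_pos_iff.2 hx) 2)) (hc x)

/-- **THE WEYL STEP**: `κ‖y‖² ≤ re⟪y, K₁y⟫` and `‖K₁y − K₂y‖ ≤ δ‖y‖` give `(κ − δ)‖y‖² ≤ re⟪y, K₂y⟫` — how the coercivity of Thm 3.11's third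
operator `Q′G′(U)²Q′*` at a near-flat `U` follows from the flat one and (3.65)–(3.67)'s difference. [folklore] [cite: Balaban1985BackgroundPropagators, (3.65)–(3.67) p.403, Thm 3.11 p.416] -/
theorem coercive_of_near {K₁ K₂ : F →ₗ[𝕜] F} {κ δ : ℝ} (hκ₁ : ∀ y, κ * ‖y‖ ^ 2 ≤ RCLike.re ⟪y, K₁ y⟫_𝕜)
    (hd : ∀ y, ‖K₁ y - K₂ y‖ ≤ δ * ‖y‖) (y : F) : (κ - δ) * ‖y‖ ^ 2 ≤ RCLike.re ⟪y, K₂ y⟫_𝕜 := by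
  have h1 : RCLike.re ⟪y, K₂ y⟫_𝕜 = RCLike.re ⟪y, K₁ y⟫_𝕜 - RCLike.re ⟪y, K₁ y - K₂ y⟫_𝕜 := by
    rw [inner_sub_right, map_sub]; ring
  have h2 : RCLike.re ⟪y, K₁ y - K₂ y⟫_𝕜 ≤ δ * ‖y‖ ^ 2 :=
    calc RCLike.re ⟪y, K₁ y - K₂ y⟫_𝕜 ≤ ‖⟪y, K₁ y - K₂ y⟫_𝕜‖ := RCLike.re_le_norm _
      _ ≤ ‖y‖ * ‖K₁ y - K₂ y‖ := norm_inner_le_norm _ _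
      _ ≤ ‖y‖ * (δ * ‖y‖) := mul_le_mul_of_nonneg_left (hd y) (norm_nonneg _)
      _ = δ * ‖y‖ ^ 2 := by ring
  rw [h1]
  nlinarith [hκ₁ y, h2]

end Abstract

/-! ## §2 The closure at `(U, 1)`: the five letters of `norm_RofU_sub_RofU_le` discharged from `t`, `ρ` and the flat form minorant `κ₀` -/

section Letters

variable {d : ℕ} (L : ℕ) [NeZero L] (m : Fin d → ℕ)
  {𝔸 : Type*} [Ring 𝔸] [Algebra ℂ 𝔸]
  {W : Type*} [NormedAddCommGroup W] [InnerProductSpace ℂ W] [FiniteDimensional ℂ W] (φ : W ≃ₗ[ℂ] 𝔸)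
  (c₀ : ℝ) [Fact (0 < c₀)] (η : ℝ) (c₁ : ℝ) [Fact (0 < c₁)] {a' : ℝ} (ha' : 0 < a')
  (U : Bond d (fineP L m) → 𝔸ˣ)
  (hRS : ∀ (b : Bond d (fineP L m)) (v u : W), ⟪adTransportW φ U b v, u⟫_ℂ = ⟪v, adTransportW φ (fun b => (U b)⁻¹) b u⟫_ℂ)
  {εR : ℝ} (hεR : 0 ≤ εR) (hRε : ∀ (b : Bond d (fineP L m)) (w : W), ‖adTransportW φ U b w - w‖ ≤ εR * ‖w‖)

include ha' hRS hεR hRε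

/-- **`‖R(U)f − R(1)f‖ ≤ C_R♯·‖f‖` WITH THE FIVE LETTERS DISCHARGED** (p. 403 «R(U), P(U) = I − R(U) … satisfy the same bounds» for the chain's
`B9Eq326OperatorAssembly.RofU` against the flat background).  Inputs DISPLAYED: `hRS`, the transporter closeness `εR`, `η ≠ 0`, `0 < ηL ≤ 1`,
`c₁(ηL)² = c₀L^d`, `0 < a′`; three primitive letters — a majorant `t` of `‖η⁻¹‖εR`, a majorant `ρ` of `ρ′ = (1+εR)^{d(L−1)} − 1`, and a
minorant `κ₀` of the FLAT third operator IN FORM, `hκ1 : ∀ ψ, κ₀‖ψ‖² ≤ re⟪ψ, Q̃′G′(1)²Q̃′†ψ⟫` (NE9 leaf-01's `qggq_coercive_one` or any sharper certificate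
inhabits it by `exact` — their located ask W-1, journal l.46789) — and the five route letters FIXED by definitional equalities (`s = (ηL)⁻¹`):
`γ = (1∕(2+2∕a′) − (√d·t + (√d·t)² + a′ρs(2s + ρs)))·s²` (leaf-03's `strong_site_coercive_canonical`, the `‖D_1λ‖²` row dropped),
`M_Q = (1+ρ)s`, `θ_Q = ρs` (leaf-03's `norm_Qtilde_flat_le` ∕ `norm_Qtilde_sub_flat_le`), `θ_G = 2(√d·t)γ⁻¹(√γ)⁻¹ + |a′|θ_Q(M_Q + M_Q)γ⁻²`
(`B9Eq364GreenLipschitzForm.norm_GpOfU_sub_GpOfU_le`, `δ_D = √d·t`), `δ_K` (S3d's `norm_Kp_sub_Kp_le`), `κ = κ₀ − δ_K` (§1 Weyl); the WINDOW is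
the pair `0 < γ`, `0 < κ`.  Conclusion: S3d's `norm_RofU_sub_RofU_le` at `(U, 1)` with its displayed `C_R♯`, `δ_K` abbreviated.
[cite: Balaban1985BackgroundPropagators, p.403, (3.25) p.394, (3.63)–(3.68) pp.402–403, Thm 3.11 p.416] -/
theorem norm_RofU_sub_RofU_one_le_of_letters (hη : η ≠ 0) (hηL0 : 0 < η * L) (hηL1 : η * L ≤ 1)
    (hs : c₁ * (η * L) ^ 2 = c₀ * (L : ℝ) ^ d) {t ρ κ₀ γ MQ θQ θG δK κ : ℝ}
    (ht : ‖((η : ℂ))⁻¹‖ * εR ≤ t) (hρ : (1 + εR) ^ (d * (L - 1)) - 1 ≤ ρ)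
    (hκ1 : ∀ ψ : SiteL2K ℂ d m c₁ W, κ₀ * ‖ψ‖ ^ 2 ≤ RCLike.re ⟪ψ,
      (((WL2.linearEquiv ℂ ℂ (fun _ : TSite d m => c₁)).symm.toLinearMap ∘ₗ
          QprimeW L m φ (fun _ : Bond d (fineP L m) => (1 : 𝔸ˣ)) (c₀ := c₀)) ∘ₗ
        GpOfU L m φ η (fun _ : Bond d (fineP L m) => (1 : 𝔸ˣ)) a' (c₁ := c₁) (laplacePrimeA_one_pos L m φ η a' hη ha') ∘ₗ
        GpOfU L m φ η (fun _ : Bond d (fineP L m) => (1 : 𝔸ˣ)) a' (c₁ := c₁) (laplacePrimeA_one_pos L m φ η a' hη ha') ∘ₗ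
        LinearMap.adjoint ((WL2.linearEquiv ℂ ℂ (fun _ : TSite d m => c₁)).symm.toLinearMap ∘ₗ
          QprimeW L m φ (fun _ : Bond d (fineP L m) => (1 : 𝔸ˣ)) (c₀ := c₀))) ψ⟫_ℂ)
    (hγdef : γ = (1 / (2 + 2 / a') - (Real.sqrt d * t + (Real.sqrt d * t) ^ 2 +
      a' * (ρ * (η * L)⁻¹) * (2 * (η * L)⁻¹ + ρ * (η * L)⁻¹))) * ((η * L)⁻¹) ^ 2)
    (hMQdef : MQ = (1 + ρ) * (η * L)⁻¹) (hθQdef : θQ = ρ * (η * L)⁻¹)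
    (hθGdef : θG = 2 * (Real.sqrt d * t) * (γ⁻¹ * (Real.sqrt γ)⁻¹) + (|a'| * θQ * (MQ + MQ)) * γ⁻¹ ^ 2)
    (hδKdef : δK = MQ * (γ⁻¹ * (γ⁻¹ * θQ + θG * MQ) + θG * (γ⁻¹ * MQ)) + θQ * (γ⁻¹ * (γ⁻¹ * MQ)))
    (hκdef : κ = κ₀ - δK) (hγ : 0 < γ) (hκ : 0 < κ)
    (f : SiteL2K ℂ d (fineP L m) c₀ W) :
    ‖RofU L m φ η U (c₀ := c₀) f - RofU L m φ η (fun _ : Bond d (fineP L m) => (1 : 𝔸ˣ)) (c₀ := c₀) f‖ ≤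
      (γ⁻¹ * (MQ * (κ⁻¹ * (MQ * θG + θQ * γ⁻¹) + κ⁻¹ * δK * κ⁻¹ * (MQ * γ⁻¹)) + θQ * (κ⁻¹ * (MQ * γ⁻¹))) +
        θG * (MQ * (κ⁻¹ * (MQ * γ⁻¹)))) * ‖f‖ := by
  have hc₀ : 0 < c₀ := Fact.out
  have hc₁ : 0 < c₁ := Fact.out
  have hLr : (0 : ℝ) < L := by exact_mod_cast Nat.pos_of_ne_zero (NeZero.ne L)
  have hη0 : 0 < η := pos_of_mul_pos_left hηL0 hLr.le
  -- the scale letter `s = (ηL)⁻¹ ≥ 1` and the weight factor `√(c₁/(c₀L^d)) = s`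
  have hs0 : 0 < (η * L)⁻¹ := by positivity
  have hs1 : (1 : ℝ) ≤ (η * L)⁻¹ := one_le_inv_iff₀.mpr ⟨hηL0, hηL1⟩
  have hratio : Real.sqrt (c₁ / (c₀ * (L : ℝ) ^ d)) = (η * L)⁻¹ := by
    have h1 : c₁ / (c₀ * (L : ℝ) ^ d) = ((η * L)⁻¹) ^ 2 := by
      rw [← hs]; field_simp
    rw [h1, Real.sqrt_sq hs0.le]
  have ht0' : 0 ≤ ‖((η : ℂ))⁻¹‖ * εR := mul_nonneg (norm_nonneg _) hεR
  have ht0 : 0 ≤ t := ht0'.trans ht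
  have hρ'0 : 0 ≤ (1 + εR) ^ (d * (L - 1)) - 1 := rho_nonneg L (d := d) hεR
  have hρ0 : 0 ≤ ρ := hρ'0.trans hρ
  have hd0 : (0 : ℝ) ≤ Real.sqrt d := Real.sqrt_nonneg _
  -- the primitive and the route letters are nonnegative
  have hMQ0 : 0 ≤ MQ := by rw [hMQdef]; positivity
  have hθQ0 : 0 ≤ θQ := by rw [hθQdef]; positivity
  have hθG0 : 0 ≤ θG := by rw [hθGdef]; positivity
  have hδK0 : 0 ≤ δK := by rw [hδKdef]; positivity
  have hκκ₀ : κ ≤ κ₀ := by rw [hκdef]; linarith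
  have hR₁ : ∀ (b : Bond d (fineP L m)) (w : W), adTransportW φ (fun _ : Bond d (fineP L m) => (1 : 𝔸ˣ)) b w = w := fun b w => by
    rw [adTransportW_one]; rfl
  have hpos₂ : ∀ x : SiteL2K ℂ d (fineP L m) c₀ W, x ≠ 0 →
      0 < RCLike.re ⟪x, laplacePrimeA L m φ η (fun _ : Bond d (fineP L m) => (1 : 𝔸ˣ)) a' (c₁ := c₁) x⟫_ℂ :=
    laplacePrimeA_one_pos L m φ η a' hη ha'
  -- (γ at U) leaf-03's strong site coercivity, the derivative row dropped, the defect majorised by `(t, ρ)`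
  have hcU : ∀ x : SiteL2K ℂ d (fineP L m) c₀ W, γ * ‖x‖ ^ 2 ≤ RCLike.re ⟪x, laplacePrimeA L m φ η U a' (c₁ := c₁) x⟫_ℂ := by
    intro x
    have h := strong_site_coercive_canonical L m φ (c₀ := c₀) (c₁ := c₁) U ha' hRS hεR hRε hηL0 hηL1 hs x
    set θ' : ℝ := Real.sqrt d * (‖((η : ℂ))⁻¹‖ * εR) + (Real.sqrt d * (‖((η : ℂ))⁻¹‖ * εR)) ^ 2 +
      a' * (((1 + εR) ^ (d * (L - 1)) - 1) * (η * L)⁻¹) * (2 * (η * L)⁻¹ + ((1 + εR) ^ (d * (L - 1)) - 1) * (η * L)⁻¹) with hθ'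
    set θb : ℝ := Real.sqrt d * t + (Real.sqrt d * t) ^ 2 + a' * (ρ * (η * L)⁻¹) * (2 * (η * L)⁻¹ + ρ * (η * L)⁻¹) with hθb
    set D : ℝ := ‖covDerivL2K ℂ c₀ ((η : ℂ))⁻¹ (adTransportW φ (fun _ : Bond d (fineP L m) => (1 : 𝔸ˣ))) x‖ ^ 2 with hD
    have hD0 : 0 ≤ D := by rw [hD]; positivity
    -- `θ′ ≤ θb` (monotone in the two primitive letters)
    have hmono : θ' ≤ θb := by
      rw [hθ', hθb]
      have h1 : Real.sqrt d * (‖((η : ℂ))⁻¹‖ * εR) ≤ Real.sqrt d * t := mul_le_mul_of_nonneg_left ht hd0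
      have h2 : (Real.sqrt d * (‖((η : ℂ))⁻¹‖ * εR)) ^ 2 ≤ (Real.sqrt d * t) ^ 2 :=
        pow_le_pow_left₀ (mul_nonneg hd0 ht0') h1 2
      have h3 : ((1 + εR) ^ (d * (L - 1)) - 1) * (η * L)⁻¹ ≤ ρ * (η * L)⁻¹ := mul_le_mul_of_nonneg_right hρ hs0.le
      have h4 : 2 * (η * L)⁻¹ + ((1 + εR) ^ (d * (L - 1)) - 1) * (η * L)⁻¹ ≤ 2 * (η * L)⁻¹ + ρ * (η * L)⁻¹ := by linarith
      have h5 : a' * (((1 + εR) ^ (d * (L - 1)) - 1) * (η * L)⁻¹) * (2 * (η * L)⁻¹ + ((1 + εR) ^ (d * (L - 1)) - 1) * (η * L)⁻¹) ≤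
          a' * (ρ * (η * L)⁻¹) * (2 * (η * L)⁻¹ + ρ * (η * L)⁻¹) :=
        mul_le_mul (mul_le_mul_of_nonneg_left h3 ha'.le) h4 (by positivity) (by positivity)
      linarith
    -- the coefficient `1/(2+2/a′) − θb = γ·s⁻² > 0`
    have hcoef : γ = (1 / (2 + 2 / a') - θb) * ((η * L)⁻¹) ^ 2 := by rw [hγdef]
    have hcb : 0 < 1 / (2 + 2 / a') - θb := by
      have : 0 < (1 / (2 + 2 / a') - θb) * ((η * L)⁻¹) ^ 2 := by rw [← hcoef]; exact hγ
      exact pos_of_mul_pos_left this (by positivity)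
    have h' : (1 / (2 + 2 / a') - θ') * (D + ((η * L)⁻¹) ^ 2 * ‖x‖ ^ 2) ≤ RCLike.re ⟪x, laplacePrimeA L m φ η U a' (c₁ := c₁) x⟫_ℂ := by
      rw [hθ', hD]; exact h
    calc γ * ‖x‖ ^ 2 = (1 / (2 + 2 / a') - θb) * (((η * L)⁻¹) ^ 2 * ‖x‖ ^ 2) := by rw [hcoef]; ring
      _ ≤ (1 / (2 + 2 / a') - θb) * (D + ((η * L)⁻¹) ^ 2 * ‖x‖ ^ 2) :=
          mul_le_mul_of_nonneg_left (le_add_of_nonneg_left hD0) hcb.le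
      _ ≤ (1 / (2 + 2 / a') - θ') * (D + ((η * L)⁻¹) ^ 2 * ‖x‖ ^ 2) :=
          mul_le_mul_of_nonneg_right (by linarith) (add_nonneg hD0 (by positivity))
      _ ≤ _ := h'
  have hpos₁ : ∀ x : SiteL2K ℂ d (fineP L m) c₀ W, x ≠ 0 → 0 < RCLike.re ⟪x, laplacePrimeA L m φ η U a' (c₁ := c₁) x⟫_ℂ :=
    pos_of_coercive hγ hcU
  -- (γ at 1) the flat strong form is at least `γ`
  have hc1 : ∀ x : SiteL2K ℂ d (fineP L m) c₀ W, γ * ‖x‖ ^ 2 ≤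
      RCLike.re ⟪x, laplacePrimeA L m φ η (fun _ : Bond d (fineP L m) => (1 : 𝔸ˣ)) a' (c₁ := c₁) x⟫_ℂ := by
    intro x
    have h := flat_site_strong_coercive L m φ (c₀ := c₀) (c₁ := c₁) hη ha' hηL0 hs x
    set D : ℝ := ‖covDerivL2K ℂ c₀ ((η : ℂ))⁻¹ (adTransportW φ (fun _ : Bond d (fineP L m) => (1 : 𝔸ˣ))) x‖ ^ 2 with hD
    have hD0 : 0 ≤ D := by rw [hD]; positivity
    have hγle : γ ≤ 1 / (2 + 2 / a') * ((η * L)⁻¹) ^ 2 := by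
      rw [hγdef]
      have hθb0 : 0 ≤ Real.sqrt d * t + (Real.sqrt d * t) ^ 2 + a' * (ρ * (η * L)⁻¹) * (2 * (η * L)⁻¹ + ρ * (η * L)⁻¹) := by positivity
      have hp := mul_nonneg hθb0 (sq_nonneg ((η * L)⁻¹))
      linarith
    have ha2 : 0 ≤ 1 / (2 + 2 / a') := by positivity
    calc γ * ‖x‖ ^ 2 ≤ 1 / (2 + 2 / a') * ((η * L)⁻¹) ^ 2 * ‖x‖ ^ 2 := mul_le_mul_of_nonneg_right hγle (sq_nonneg _)
      _ ≤ 1 / (2 + 2 / a') * (D + ((η * L)⁻¹) ^ 2 * ‖x‖ ^ 2) := by linarith [mul_nonneg ha2 hD0]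
      _ ≤ _ := h
  -- (M_Q, θ_Q) leaf-03's `Q̃′`-letters in the `c₁`-currency, read through `√(c₁/(c₀L^d)) = s`
  have hq1 : ∀ x : SiteL2K ℂ d (fineP L m) c₀ W, ‖((WL2.linearEquiv ℂ ℂ (fun _ : TSite d m => c₁)).symm.toLinearMap ∘ₗ
      QprimeW L m φ (fun _ : Bond d (fineP L m) => (1 : 𝔸ˣ)) (c₀ := c₀)) x‖ ≤ MQ * ‖x‖ := by
    intro x
    have h := norm_Qtilde_flat_le L m φ (c₀ := c₀) (c₁ := c₁) (𝔸 := 𝔸) x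
    rw [hratio] at h
    refine h.trans (mul_le_mul_of_nonneg_right ?_ (norm_nonneg _))
    rw [hMQdef]; exact le_mul_of_one_le_left hs0.le (by linarith)
  have hdq : ∀ x : SiteL2K ℂ d (fineP L m) c₀ W, ‖((WL2.linearEquiv ℂ ℂ (fun _ : TSite d m => c₁)).symm.toLinearMap ∘ₗ QprimeW L m φ U (c₀ := c₀)) x -
      ((WL2.linearEquiv ℂ ℂ (fun _ : TSite d m => c₁)).symm.toLinearMap ∘ₗ QprimeW L m φ (fun _ : Bond d (fineP L m) => (1 : 𝔸ˣ)) (c₀ := c₀)) x‖ ≤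
      θQ * ‖x‖ := by
    intro x
    have h := norm_Qtilde_sub_flat_le L m φ (c₀ := c₀) (c₁ := c₁) U hεR hRε x
    rw [hratio] at h
    refine h.trans (mul_le_mul_of_nonneg_right ?_ (norm_nonneg _))
    rw [hθQdef]; exact mul_le_mul_of_nonneg_right hρ hs0.le
  have hdq' : ∀ x : SiteL2K ℂ d (fineP L m) c₀ W,
      ‖((WL2.linearEquiv ℂ ℂ (fun _ : TSite d m => c₁)).symm.toLinearMap ∘ₗ QprimeW L m φ (fun _ : Bond d (fineP L m) => (1 : 𝔸ˣ)) (c₀ := c₀)) x -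
      ((WL2.linearEquiv ℂ ℂ (fun _ : TSite d m => c₁)).symm.toLinearMap ∘ₗ QprimeW L m φ U (c₀ := c₀)) x‖ ≤ θQ * ‖x‖ := fun x => by
    rw [norm_sub_rev]; exact hdq x
  have hqU : ∀ x : SiteL2K ℂ d (fineP L m) c₀ W, ‖((WL2.linearEquiv ℂ ℂ (fun _ : TSite d m => c₁)).symm.toLinearMap ∘ₗ
      QprimeW L m φ U (c₀ := c₀)) x‖ ≤ MQ * ‖x‖ := by
    intro x
    have h1 := norm_Qtilde_flat_le L m φ (c₀ := c₀) (c₁ := c₁) (𝔸 := 𝔸) x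
    have h2 := norm_Qtilde_sub_flat_le L m φ (c₀ := c₀) (c₁ := c₁) U hεR hRε x
    rw [hratio] at h1 h2
    have h3 := norm_le_norm_add_norm_sub'
      (((WL2.linearEquiv ℂ ℂ (fun _ : TSite d m => c₁)).symm.toLinearMap ∘ₗ QprimeW L m φ U (c₀ := c₀)) x)
      (((WL2.linearEquiv ℂ ℂ (fun _ : TSite d m => c₁)).symm.toLinearMap ∘ₗ QprimeW L m φ (fun _ : Bond d (fineP L m) => (1 : 𝔸ˣ)) (c₀ := c₀)) x)
    have h4 : ((1 + εR) ^ (d * (L - 1)) - 1) * (η * L)⁻¹ * ‖x‖ ≤ ρ * (η * L)⁻¹ * ‖x‖ :=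
      mul_le_mul_of_nonneg_right (mul_le_mul_of_nonneg_right hρ hs0.le) (norm_nonneg _)
    rw [hMQdef]
    set A := ‖((WL2.linearEquiv ℂ ℂ (fun _ : TSite d m => c₁)).symm.toLinearMap ∘ₗ QprimeW L m φ U (c₀ := c₀)) x‖ with hA
    set B := ‖((WL2.linearEquiv ℂ ℂ (fun _ : TSite d m => c₁)).symm.toLinearMap ∘ₗ
      QprimeW L m φ (fun _ : Bond d (fineP L m) => (1 : 𝔸ˣ)) (c₀ := c₀)) x‖ with hB
    set C := ‖((WL2.linearEquiv ℂ ℂ (fun _ : TSite d m => c₁)).symm.toLinearMap ∘ₗ QprimeW L m φ U (c₀ := c₀)) x -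
      ((WL2.linearEquiv ℂ ℂ (fun _ : TSite d m => c₁)).symm.toLinearMap ∘ₗ QprimeW L m φ (fun _ : Bond d (fineP L m) => (1 : 𝔸ˣ)) (c₀ := c₀)) x‖
      with hC
    have e : (1 + ρ) * (η * L)⁻¹ * ‖x‖ = (η * L)⁻¹ * ‖x‖ + ρ * (η * L)⁻¹ * ‖x‖ := by ring
    rw [e]
    linarith
  -- (δ_D) the derivative remainder `‖D_U x − D_1 x‖ ≤ √d·t·‖x‖`
  have hD : ∀ x : SiteL2K ℂ d (fineP L m) c₀ W, ‖covDerivL2K ℂ c₀ ((η : ℂ))⁻¹ (adTransportW φ U) x -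
      covDerivL2K ℂ c₀ ((η : ℂ))⁻¹ (adTransportW φ (fun _ : Bond d (fineP L m) => (1 : 𝔸ˣ))) x‖ ≤ Real.sqrt d * t * ‖x‖ := by
    intro x
    refine (norm_covDerivL2K_sub_le _ hεR hRε hR₁ x).trans ?_
    have : ‖((η : ℂ))⁻¹‖ * εR * Real.sqrt d ≤ Real.sqrt d * t := by
      rw [mul_comm]; exact mul_le_mul_of_nonneg_left ht hd0
    exact mul_le_mul_of_nonneg_right this (norm_nonneg _)
  have hD' : ∀ x : SiteL2K ℂ d (fineP L m) c₀ W, ‖covDerivL2K ℂ c₀ ((η : ℂ))⁻¹ (adTransportW φ (fun _ : Bond d (fineP L m) => (1 : 𝔸ˣ))) x -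
      covDerivL2K ℂ c₀ ((η : ℂ))⁻¹ (adTransportW φ U) x‖ ≤ Real.sqrt d * t * ‖x‖ := fun x => by
    rw [norm_sub_rev]; exact hD x
  -- (θ_G) the form-relative resolvent step of `B9Eq364GreenLipschitzForm` at `(U, 1)`
  have hG : ∀ y : SiteL2K ℂ d (fineP L m) c₀ W, ‖GpOfU L m φ η U a' (c₁ := c₁) hpos₁ y -
      GpOfU L m φ η (fun _ : Bond d (fineP L m) => (1 : 𝔸ˣ)) a' (c₁ := c₁) hpos₂ y‖ ≤ θG * ‖y‖ := by
    intro y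
    rw [hθGdef]
    exact norm_GpOfU_sub_GpOfU_le L m φ c₀ η U (fun _ : Bond d (fineP L m) => (1 : 𝔸ˣ)) c₁ a' ha'.le hRS (hRS_one φ) hpos₁ hpos₂
      hγ (by positivity) hMQ0 hMQ0 hθQ0 hcU hc1 hD' hqU hq1 hdq' y
  -- (δ_K) S3d's four-factor telescoping at `(1, U)`, then the Weyl step
  have hKd : ∀ ψ : SiteL2K ℂ d m c₁ W, ‖(((WL2.linearEquiv ℂ ℂ (fun _ : TSite d m => c₁)).symm.toLinearMap ∘ₗ
          QprimeW L m φ (fun _ : Bond d (fineP L m) => (1 : 𝔸ˣ)) (c₀ := c₀)) ∘ₗ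
        GpOfU L m φ η (fun _ : Bond d (fineP L m) => (1 : 𝔸ˣ)) a' (c₁ := c₁) hpos₂ ∘ₗ
        GpOfU L m φ η (fun _ : Bond d (fineP L m) => (1 : 𝔸ˣ)) a' (c₁ := c₁) hpos₂ ∘ₗ
        LinearMap.adjoint ((WL2.linearEquiv ℂ ℂ (fun _ : TSite d m => c₁)).symm.toLinearMap ∘ₗ
          QprimeW L m φ (fun _ : Bond d (fineP L m) => (1 : 𝔸ˣ)) (c₀ := c₀))) ψ -
      (((WL2.linearEquiv ℂ ℂ (fun _ : TSite d m => c₁)).symm.toLinearMap ∘ₗ QprimeW L m φ U (c₀ := c₀)) ∘ₗ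
        GpOfU L m φ η U a' (c₁ := c₁) hpos₁ ∘ₗ GpOfU L m φ η U a' (c₁ := c₁) hpos₁ ∘ₗ
        LinearMap.adjoint ((WL2.linearEquiv ℂ ℂ (fun _ : TSite d m => c₁)).symm.toLinearMap ∘ₗ QprimeW L m φ U (c₀ := c₀))) ψ‖ ≤
      δK * ‖ψ‖ := by
    intro ψ
    rw [hδKdef]
    unfold GpOfU
    exact norm_Kp_sub_Kp_le hpos₂ hpos₁ hγ hMQ0 hθG0 hθQ0 hc1 hcU (fun y => by rw [norm_sub_rev]; exact hG y) hq1 hqU hdq' ψ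
  have hκU : ∀ ψ : SiteL2K ℂ d m c₁ W, κ * ‖ψ‖ ^ 2 ≤ RCLike.re ⟪ψ,
      (((WL2.linearEquiv ℂ ℂ (fun _ : TSite d m => c₁)).symm.toLinearMap ∘ₗ QprimeW L m φ U (c₀ := c₀)) ∘ₗ
        GpOfU L m φ η U a' (c₁ := c₁) hpos₁ ∘ₗ GpOfU L m φ η U a' (c₁ := c₁) hpos₁ ∘ₗ
        LinearMap.adjoint ((WL2.linearEquiv ℂ ℂ (fun _ : TSite d m => c₁)).symm.toLinearMap ∘ₗ QprimeW L m φ U (c₀ := c₀))) ψ⟫_ℂ := by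
    intro ψ
    rw [hκdef]
    exact coercive_of_near hκ1 hKd ψ
  have h := norm_RofU_sub_RofU_le L m φ c₀ η U (fun _ : Bond d (fineP L m) => (1 : 𝔸ˣ)) c₁ a' hRS (hRS_one φ) hpos₁ hpos₂
    hγ hMQ0 hθG0 hθQ0 hκ hcU hc1 hG hqU hq1 hdq hκU (fun ψ => (mul_le_mul_of_nonneg_right hκκ₀ (sq_nonneg _)).trans (hκ1 ψ)) f
  rw [hδKdef]
  exact h

end Letters

/-! ## §3 The diagonal `ηL = 1`, `c₀L^d = c₁`, `εR = K·α·η`: every letter a function of `(d, a′, K, α)` -/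

/-- `(1 + x/n·…)`-type bound: `(1 + Kαη)^{d(L−1)} − 1 ≤ e^{dKα} − 1` on the diagonal `ηL = 1` (`1 + y ≤ e^y`, `d(L−1)·Kα∕L ≤ dKα`).
[folklore] [cite: Balaban1985BackgroundPropagators, (3.35) p.396, p.403] -/
theorem rho_le_exp_sub_one {d L : ℕ} [NeZero L] {η K α : ℝ} (hK : 0 ≤ K) (hα : 0 ≤ α) (hηL : η * L = 1) :
    (1 + K * α * η) ^ (d * (L - 1)) - 1 ≤ Real.exp (d * K * α) - 1 := by
  have hLr : (0 : ℝ) < L := by exact_mod_cast Nat.pos_of_ne_zero (NeZero.ne L)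
  have hη0 : 0 < η := by
    have : 0 < η * L := by rw [hηL]; exact one_pos
    exact pos_of_mul_pos_left this hLr.le
  have hx0 : 0 ≤ K * α * η := by positivity
  have h1 : (1 + K * α * η) ^ (d * (L - 1)) ≤ Real.exp (K * α * η) ^ (d * (L - 1)) :=
    pow_le_pow_left₀ (by positivity) (by linarith [Real.add_one_le_exp (K * α * η)]) _
  have h2 : Real.exp (K * α * η) ^ (d * (L - 1)) = Real.exp (((d * (L - 1) : ℕ) : ℝ) * (K * α * η)) := by
    rw [← Real.exp_nat_mul]
  have hL1 : ((L - 1 : ℕ) : ℝ) ≤ L := by exact_mod_cast Nat.sub_le L 1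
  have h3 : ((d * (L - 1) : ℕ) : ℝ) * (K * α * η) ≤ d * K * α := by
    rw [Nat.cast_mul]
    have hη' : η = 1 / L := by field_simp; linarith
    rw [hη']
    have : ((L - 1 : ℕ) : ℝ) * (1 / L) ≤ 1 := by
      rw [mul_one_div, div_le_one hLr]; exact hL1
    calc (d : ℝ) * ((L - 1 : ℕ) : ℝ) * (K * α * (1 / L)) = d * K * α * (((L - 1 : ℕ) : ℝ) * (1 / L)) := by ring
      _ ≤ d * K * α * 1 := mul_le_mul_of_nonneg_left this (by positivity)
      _ = d * K * α := by ring
  have h4 : Real.exp (((d * (L - 1) : ℕ) : ℝ) * (K * α * η)) ≤ Real.exp (d * K * α) := Real.exp_le_exp.2 h3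
  linarith [h1, h2.le, h4]

section Diagonal

variable {d : ℕ} (L : ℕ) [NeZero L] (m : Fin d → ℕ) [∀ i, NeZero (fineP L m i)]
  {𝔸 : Type*} [Ring 𝔸] [Algebra ℂ 𝔸]
  {W : Type*} [NormedAddCommGroup W] [InnerProductSpace ℂ W] [FiniteDimensional ℂ W] (φ : W ≃ₗ[ℂ] 𝔸)
  (c₀ : ℝ) [Fact (0 < c₀)] (η : ℝ) (c₁ : ℝ) [Fact (0 < c₁)] {a' : ℝ} (ha' : 0 < a')
  (U : Bond d (fineP L m) → 𝔸ˣ)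
  (hRS : ∀ (b : Bond d (fineP L m)) (v u : W), ⟪adTransportW φ U b v, u⟫_ℂ = ⟪v, adTransportW φ (fun b => (U b)⁻¹) b u⟫_ℂ)
  {K α : ℝ} (hK : 0 ≤ K) (hα : 0 ≤ α) (hRε : ∀ (b : Bond d (fineP L m)) (w : W), ‖adTransportW φ U b w - w‖ ≤ K * α * η * ‖w‖)

include ha' hRS hK hα hRε

/-- **THE CLOSURE ON BAŁABAN's DIAGONAL — `C_R♯ = C_R♯(d, a′, K, α)`**: at `ηL = 1`, canonical weights `c₀L^d = c₁`, transporters `Kαη`-close to the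
identity (`K = 2M_φM_φ′` in the chain, `α` print's scaled window (3.35)), `3 ≤ L`, `0 < a′`, the five letters of S3d are the closed forms
`γ = 1∕(2+2∕a′) − (√d·Kα + (√d·Kα)² + a′(e^{dKα} − 1)(2 + (e^{dKα} − 1)))`, `M_Q = e^{dKα}`, `θ_Q = e^{dKα} − 1`,
`θ_G = 2√d·Kα·γ⁻¹(√γ)⁻¹ + |a′|θ_Q(M_Q + M_Q)γ⁻²`, `δ_K` (displayed), `κ = 1∕(16d(729∕16)^d + a′)² − δ_K` — functions of `(d, a′, K, α)` ONLY (no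
`η`, `L`, `m`, `c₀`, `c₁`) — and, in the window `0 < γ`, `0 < κ`, `‖R(U)f − R(1)f‖ ≤ C_R♯(γ, θ_G, M_Q, θ_Q, κ)·‖f‖`: §2 with `t = Kα`, `ρ = e^{dKα} − 1`,
`s = 1`, `κ₀` = NE9 leaf-01's `qggq_constant_diagonal_ge`.  The first η-, L-, volume-free `C_R` of the chain at `U ≠ 1`; consumer slot: NE9 leaf-03's
`B9Eq382FormRelativeNearFlat` `δ_R`. [cite: Balaban1985BackgroundPropagators, p.403, (3.25) p.394, (3.35) p.396, (3.63)–(3.68) pp.402–403, Thm 3.11 p.416] -/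
theorem norm_RofU_sub_RofU_one_le_diagonal (hL3 : 3 ≤ L) (hηL : η * L = 1) (hw : c₀ * (L : ℝ) ^ d = c₁) {γ MQ θQ θG δK κ : ℝ}
    (hγdef : γ = 1 / (2 + 2 / a') - (Real.sqrt d * (K * α) + (Real.sqrt d * (K * α)) ^ 2 +
      a' * (Real.exp (d * K * α) - 1) * (2 + (Real.exp (d * K * α) - 1))))
    (hMQdef : MQ = Real.exp (d * K * α)) (hθQdef : θQ = Real.exp (d * K * α) - 1)
    (hθGdef : θG = 2 * (Real.sqrt d * (K * α)) * (γ⁻¹ * (Real.sqrt γ)⁻¹) + (|a'| * θQ * (MQ + MQ)) * γ⁻¹ ^ 2)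
    (hδKdef : δK = MQ * (γ⁻¹ * (γ⁻¹ * θQ + θG * MQ) + θG * (γ⁻¹ * MQ)) + θQ * (γ⁻¹ * (γ⁻¹ * MQ)))
    (hκdef : κ = 1 / (16 * (d : ℝ) * (729 / 16) ^ d + a') ^ 2 - δK) (hγ : 0 < γ) (hκ : 0 < κ)
    (f : SiteL2K ℂ d (fineP L m) c₀ W) :
    ‖RofU L m φ η U (c₀ := c₀) f - RofU L m φ η (fun _ : Bond d (fineP L m) => (1 : 𝔸ˣ)) (c₀ := c₀) f‖ ≤
      (γ⁻¹ * (MQ * (κ⁻¹ * (MQ * θG + θQ * γ⁻¹) + κ⁻¹ * δK * κ⁻¹ * (MQ * γ⁻¹)) + θQ * (κ⁻¹ * (MQ * γ⁻¹))) +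
        θG * (MQ * (κ⁻¹ * (MQ * γ⁻¹)))) * ‖f‖ := by
  have hc₁ : 0 < c₁ := Fact.out
  have hLr : (0 : ℝ) < L := by exact_mod_cast Nat.pos_of_ne_zero (NeZero.ne L)
  have hηL0 : 0 < η * L := by rw [hηL]; exact one_pos
  have hη0 : 0 < η := pos_of_mul_pos_left hηL0 hLr.le
  have hs : c₁ * (η * L) ^ 2 = c₀ * (L : ℝ) ^ d := by rw [hηL, one_pow, mul_one, hw]
  have hone : (η * L)⁻¹ = 1 := by rw [hηL, inv_one]
  -- the three primitive letters on the diagonal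
  have ht : ‖((η : ℂ))⁻¹‖ * (K * α * η) ≤ K * α := by
    rw [norm_inv, Complex.norm_real, Real.norm_eq_abs, abs_of_pos hη0]
    rw [show η⁻¹ * (K * α * η) = K * α * (η⁻¹ * η) by ring, inv_mul_cancel₀ hη0.ne', mul_one]
  have hρ := rho_le_exp_sub_one (d := d) hK hα hηL
  have hκ₀ := qggq_constant_diagonal_ge (d := d) hL3 hηL hw hc₁ ha'
  refine norm_RofU_sub_RofU_one_le_of_letters L m φ c₀ η c₁ ha' U hRS (by positivity : 0 ≤ K * α * η) hRε hη0.ne' hηL0 (le_of_eq hηL) hs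
    ht hρ (fun ψ => (mul_le_mul_of_nonneg_right hκ₀ (sq_nonneg _)).trans (qggq_coercive_one L m φ c₀ η c₁ hL3 hη0.ne' ha' ψ))
    ?_ ?_ ?_ hθGdef hδKdef hκdef hγ hκ f
  · rw [hγdef, hone]; ring
  · rw [hMQdef, hone]; ring
  · rw [hθQdef, hone, mul_one]

end Diagonal

end Literature.MathematicalPhysics.QuantumFieldTheory.Balaban1983to89.B9Eq325RLipschitzClosed

end
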